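import Mathlib.Data.Real.Basic
import Mathlib.Tactic
import HarnessLib

/-!
# The three-apex monoid: the CORNER LEMMA (CL) — tangent cone of the fibre-top lemmas at the identity

Helper file (`--supports stmt-CriticalPhenomena-4575`), FK sub-lane `prim-bschramm-fk-3` (gen 17); builds on p205010 (kernel theorem,
internal audit signed; external expert review pending).  No sorries; standard axioms.  Memos `bschramm/prim-bschramm-fk-3/T3-ENVELOPE.md` §11–13,
`T3-FIBRE.md` §0.

Blowing up the envelope statement (A) (`EnvelopeA q`, file `…T3Envelope`) at the identity corner of the monoid (`x̂ = û(1+εa)`, `ŷ = û(1+εb)`,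
`ẑ = û(1+εc)`, `q = εk`, `Λ/û² = ε²λ`) gives at order `ε²` the tangent problem `V = S² − λ(1+θ+θ')² + kP₁ + k²Q ≥ 0` under the `U_a`-bound
`λ ≤ k·ab/(a+b)` (case `b ≤ c`; memo T3-ENVELOPE §11, §13), i.e. the polynomial inequality

  `(CL)  (a+b)·S² + k·C₁ + k²·(a+b)·Q ≥ 0`,  `S = a − θb − θ'c − θθ'(b+c)`,  `Q = θθ'(2+2θ+2θ'+θθ')`,  `C₁ = (a+b)P₁ − ab(1+θ+θ')²`,

for `a, b, k, θ, θ' ≥ 0`, `c ≥ b`.  This file proves (CL) by an exact SOS-on-the-orthant certificate (found in this generation, lab/cl_cert1.py):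
`(a+b+k)·CL = ((a+b+k)(a−θb) − θ'·[(a+b)(c+θ(b+c)) + k(aθ+b)])² + θ'·H₀ + θ'²·H₁` with `H₀, H₁` polynomials with non-negative integer
coefficients in `a, b, c−b, k, θ`.  (CL) is the common leading-order form of both fibre-top lemmas `FibreTopHarm`, `FibreTopCap`
(file `…T3EnvelopeFibreTop`); it is false without `b ≤ c` (memo T3-FIBRE §0), which is why the fibre-top argument splits `Z_ac ≤ Z_bc` / mirror. [folklore]
-/

noncomputable section

namespace Summit.CriticalPhenomena.PercolationContinuityZ3.Theorems

namespace FK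

namespace ThreeApex

/-- The corner polynomial `CL(a,b,c,k,θ,θ') = (a+b)S² + k·C₁ + k²(a+b)Q` of memo T3-ENVELOPE §13 (tangent cone of (A) at the identity, with the
`U_a`-bound substituted). [folklore] -/
def cornerCL (a b c k t s : ℝ) : ℝ :=
  (a + b) * (a - t * b - s * c - t * s * (b + c)) ^ (2 : ℕ)
  + k * ((a + b) * (a + b * t ^ (2 : ℕ) + c * s ^ (2 : ℕ) + 2 * (b + c - a) * t * s + 4 * b * t ^ (2 : ℕ) * s + 4 * c * t * s ^ (2 : ℕ) + 2 * b * t * s ^ (2 : ℕ)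
      + 2 * c * t ^ (2 : ℕ) * s + 2 * (b + c) * t ^ (2 : ℕ) * s ^ (2 : ℕ)) - a * b * (1 + t + s) ^ (2 : ℕ))
  + k ^ (2 : ℕ) * (a + b) * (t * s * (2 + 2 * t + 2 * s + t * s))

set_option maxRecDepth 4000 in
/-- Certificate polynomial `H₀` (coefficient of `θ'`): non-negative integer coefficients in `a, b, d = c − b, k, θ`. [folklore] -/
def cornerH0 (a b d k t : ℝ) : ℝ :=
    2 * b * k ^ (3 : ℕ) * t ^ (2 : ℕ) + 2 * b * d * k ^ (2 : ℕ) * t ^ (2 : ℕ) + 8 * b ^ (2 : ℕ) * k ^ (2 : ℕ) * t ^ (2 : ℕ) + 2 * b ^ (2 : ℕ) * d * k * t ^ (2 : ℕ)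
    + 6 * b ^ (3 : ℕ) * k * t ^ (2 : ℕ) + 2 * a * k ^ (3 : ℕ) * t ^ (2 : ℕ) + 2 * a * d * k ^ (2 : ℕ) * t ^ (2 : ℕ) + 8 * a * b * k ^ (2 : ℕ) * t ^ (2 : ℕ)
    + 4 * a * b * d * k * t ^ (2 : ℕ) + 10 * a * b ^ (2 : ℕ) * k * t ^ (2 : ℕ) + 2 * a ^ (2 : ℕ) * k ^ (2 : ℕ) * t ^ (2 : ℕ) + 2 * a ^ (2 : ℕ) * d * k * t ^ (2 : ℕ)
    + 4 * a ^ (2 : ℕ) * b * k * t ^ (2 : ℕ) + 2 * b * k ^ (3 : ℕ) * t + 2 * b * d * k ^ (2 : ℕ) * t + 4 * b ^ (2 : ℕ) * k ^ (2 : ℕ) * t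
    + 2 * b ^ (2 : ℕ) * d * k * t + 2 * b ^ (3 : ℕ) * k * t + 2 * a * k ^ (3 : ℕ) * t + 2 * a * d * k ^ (2 : ℕ) * t
    + 4 * a * b * k ^ (2 : ℕ) * t + 4 * a * b * d * k * t + 2 * a * b ^ (2 : ℕ) * k * t + 2 * a ^ (2 : ℕ) * k ^ (2 : ℕ) * t
    + 2 * a ^ (2 : ℕ) * d * k * t

set_option maxRecDepth 4000 in
/-- Certificate polynomial `H₁` (coefficient of `θ'²`): non-negative integer coefficients in `a, b, d = c − b, k, θ`. [folklore] -/
def cornerH1 (a b d k t : ℝ) : ℝ :=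
    b * k ^ (3 : ℕ) * t ^ (2 : ℕ) + 2 * b * d * k ^ (2 : ℕ) * t ^ (2 : ℕ) + b * d ^ (2 : ℕ) * k * t ^ (2 : ℕ) + 5 * b ^ (2 : ℕ) * k ^ (2 : ℕ) * t ^ (2 : ℕ)
    + 6 * b ^ (2 : ℕ) * d * k * t ^ (2 : ℕ) + 8 * b ^ (3 : ℕ) * k * t ^ (2 : ℕ) + a * k ^ (3 : ℕ) * t ^ (2 : ℕ) + 2 * a * d * k ^ (2 : ℕ) * t ^ (2 : ℕ)
    + a * d ^ (2 : ℕ) * k * t ^ (2 : ℕ) + 6 * a * b * k ^ (2 : ℕ) * t ^ (2 : ℕ) + 6 * a * b * d * k * t ^ (2 : ℕ) + 8 * a * b ^ (2 : ℕ) * k * t ^ (2 : ℕ)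
    + 2 * b * k ^ (3 : ℕ) * t + 4 * b * d * k ^ (2 : ℕ) * t + 2 * b * d ^ (2 : ℕ) * k * t + 8 * b ^ (2 : ℕ) * k ^ (2 : ℕ) * t
    + 8 * b ^ (2 : ℕ) * d * k * t + 6 * b ^ (3 : ℕ) * k * t + 2 * a * k ^ (3 : ℕ) * t + 4 * a * d * k ^ (2 : ℕ) * t
    + 2 * a * d ^ (2 : ℕ) * k * t + 8 * a * b * k ^ (2 : ℕ) * t + 10 * a * b * d * k * t + 10 * a * b ^ (2 : ℕ) * k * t
    + 2 * a ^ (2 : ℕ) * k ^ (2 : ℕ) * t + 2 * a ^ (2 : ℕ) * d * k * t + 4 * a ^ (2 : ℕ) * b * k * t + b * d * k ^ (2 : ℕ)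
    + b * d ^ (2 : ℕ) * k + b ^ (2 : ℕ) * d * k + a * d * k ^ (2 : ℕ) + a * d ^ (2 : ℕ) * k
    + 2 * a * b * d * k + a ^ (2 : ℕ) * d * k

set_option maxHeartbeats 4000000 in
/-- **The certificate identity**: `(a+b+k)·CL(a,b,b+d,k,θ,θ') = ((a+b+k)(a−θb) − θ'G)² + θ'H₀ + θ'²H₁`,
`G = (a+b)((b+d) + θ(2b+d)) + k(aθ+b)`. [folklore] -/
theorem cornerCL_identity (a b d k t s : ℝ) :
    (a + b + k) * cornerCL a b (b + d) k t s =
      ((a + b + k) * (a - t * b) - s * ((a + b) * ((b + d) + t * (2 * b + d)) + k * (a * t + b))) ^ (2 : ℕ)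
        + s * cornerH0 a b d k t + s ^ (2 : ℕ) * cornerH1 a b d k t := by
  unfold cornerCL cornerH0 cornerH1
  ring

/-- **The corner lemma (CL)**: for `a, b, k, θ, θ' ≥ 0` and `c ≥ b`, `CL(a,b,c,k,θ,θ') ≥ 0`. [folklore] -/
theorem cornerCL_nonneg {a b c k t s : ℝ} (ha : 0 ≤ a) (hb : 0 ≤ b) (hbc : b ≤ c) (hk : 0 ≤ k) (ht : 0 ≤ t) (hs : 0 ≤ s) :
    0 ≤ cornerCL a b c k t s := by
  -- degenerate multiplier: a + b + k = 0 forces a = b = k = 0 and then CL = 0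
  rcases eq_or_lt_of_le (show 0 ≤ a + b + k by linarith) with h0 | hpos
  · have ha0 : a = 0 := by linarith
    have hb0 : b = 0 := by linarith
    have hk0 : k = 0 := by linarith
    subst ha0; subst hb0; subst hk0
    simp [cornerCL]
  · set d := c - b with hd_def
    have hd : 0 ≤ d := by rw [hd_def]; linarith
    have hc : c = b + d := by rw [hd_def]; ring
    rw [hc]
    have h0 : 0 ≤ cornerH0 a b d k t := by unfold cornerH0; positivity
    have h1 : 0 ≤ cornerH1 a b d k t := by unfold cornerH1; positivity
    have key := cornerCL_identity a b d k t s
    have hR : 0 ≤ (a + b + k) * cornerCL a b (b + d) k t s := by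
      rw [key]
      have := sq_nonneg ((a + b + k) * (a - t * b) - s * ((a + b) * ((b + d) + t * (2 * b + d)) + k * (a * t + b)))
      positivity
    exact le_of_mul_le_mul_left (by rw [mul_zero]; exact hR) hpos

end ThreeApex

end FK

end Summit.CriticalPhenomena.PercolationContinuityZ3.Theorems
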